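import Summits.Ventures.Crystal3D.Theorems.StickyWulffConstantCoaxialWallLawPayerTwinCellTwoPlateRowA
import Summits.Ventures.Crystal3D.Theorems.StickyWulffConstantCoaxialWallLawReducedWordRigidity
import HarnessLib

/-!
# The TWO-FAMILY row cell of the OneFcc F_layer: two typed end-pair sets under the twin row of record (file (D′), plate-free)

HONEST FRAMING. Venture `Summits/Ventures/Crystal3D` (cell `crystal3d-full`); helper `--supports` the crux `CoaxialWallLaw`
(stmt-Ventures-19481, REGISTERED line `WallLedgerF`) in its role as owner of lane T's debt T-F2 / F_layer, OneFcc half (cf-p1 (civ)/(cxx)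
«OneFcc = TWO FAMILIES»: the census row pays `Σ(12 − deg) ≥ #ends / sF`, so BOTH families' ends must be pooled under ONE row; memo
HOME/wall-19481-p1/g16/TWO-FAMILY-LEDGER-g16.md).  The row BY NAME (`LocalEndRowA`, the shape of `EndRowTwinHalfTurnA … L`); census-free,
plate-free, standard axioms; nothing about the crux is claimed; F-C1 not moved.

This is the plate-agnostic core of `wordNet_twin_payers_ge_twoPlate_rowA` (…PayerTwinCellTwoPlateRowA, the fcc twin cell): given, in ONE
`1`-separated configuration `X`,
* a pair set `T₁` typed over the BOTTOM system `S₁ = ⟨L, inPlaneRoots L 1⟩` in the `WFChain` form of the Barlow exports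
  (`wordNet_barlow_endPairs_oneFcc` p698172, `wordNet_barlow_endPairs_oneFccB`): balls, two payers, `∃ r κ, WFChain r κ ∧ predecessor ∧ IsEndMove`;
* a pair set `T₂` typed over the TOP system `S₂ = ⟨H ≫ L, inPlaneRoots (H ≫ L) (−1)⟩` in the two forms delivered by the cell-mirror transport
  `endPairs_pullback_mirror` (…OneFccMirrorTransport): the `κ ++ [e₃]` SHAPE form and the admissible-class form;
* end balls of both sets at heights in `[wlo, whi]`, and the LOCAL ROW `LocalEndRowA ver sF S₁ S₂`,
then `T₁`, `T₂` are DISJOINT (LEMMA X″ `word_target_ne_twoPlate_shape₂`: a bottom class and a top class never produce the same move) and every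
pair of the union is an `IsEndPairA` of `(S₁, S₂)`, so `card_endPairs_le_of_localRow` gives
**`twoFamily_endPairs_le_row`**: `#T₁ + #T₂ ≤ sF · Σ_{z ∈ X, deg z ≤ 11, wlo − 1 ≤ z₂ ≤ whi + 1} (12 − deg z)`.
WHAT THIS IS NOT: no census, no flux, no plates; F-C1 not moved.
-/

noncomputable section

namespace Summit.Ventures.Crystal3D.Theorems

open Summit.Ventures.Crystal3D Finset
open scoped InnerProductSpace

open scoped Classical in
/-- **Two typed end-pair families under the twin row.**  See the module docstring. -/
theorem twoFamily_endPairs_le_row (ver : WordVersion) (L : EuclideanSpace ℝ (Fin 3) ≃ₗᵢ[ℝ] EuclideanSpace ℝ (Fin 3)) {sF : ℝ}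
    (hrow : LocalEndRowA ver sF ⟨L, inPlaneRoots L 1⟩
      ⟨((ℝ ∙ EuclideanSpace.single (2 : Fin 3) (1 : ℝ)).reflection).trans L,
        inPlaneRoots (((ℝ ∙ EuclideanSpace.single (2 : Fin 3) (1 : ℝ)).reflection).trans L) (-1)⟩)
    (X : Finset (EuclideanSpace ℝ (Fin 3))) (hX : ∀ p ∈ X, ∀ q ∈ X, p ≠ q → 1 ≤ dist p q) (wlo whi : ℝ)
    (T₁ T₂ : Finset (EuclideanSpace ℝ (Fin 3) × EuclideanSpace ℝ (Fin 3)))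
    -- the bottom family, typed over `S₁` in the `WFChain` form
    (hT₁pair : ∀ bq ∈ T₁, bq.1 ∈ X ∧ bq.2 ∈ X ∧ wlo ≤ bq.1 2 ∧ bq.1 2 ≤ whi)
    (hT₁pay : ∀ bq ∈ T₁, (X.filter fun q => dist bq.1 q = 1).card ≤ 11 ∨
      ∃ z₁ ∈ X, ∃ z₂ ∈ X, z₁ ≠ z₂ ∧ dist bq.1 z₁ = 1 ∧ dist bq.1 z₂ = 1 ∧
        (X.filter fun q => dist z₁ q = 1).card ≤ 11 ∧ (X.filter fun q => dist z₂ q = 1).card ≤ 11)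
    (hT₁wit : ∀ bq ∈ T₁, ∃ r ∈ inPlaneRoots L 1, ∃ κ : List (EuclideanSpace ℝ (Fin 3)), WFChain r κ ∧
      bq.2 - (⟨L, inPlaneRoots L 1⟩ : PlateSystem).Fw κ (((-1 : ℝ) ^ κ.length) • r) ∈ X ∧
      IsEndMove X ver ((⟨L, inPlaneRoots L 1⟩ : PlateSystem).Fw κ)
        ((⟨L, inPlaneRoots L 1⟩ : PlateSystem).Fw κ (((-1 : ℝ) ^ κ.length) • r)) bq.2 bq.1)
    -- the top family, typed over `S₂` in the SHAPE form and the admissible-class form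
    (hT₂pair : ∀ bq ∈ T₂, bq.1 ∈ X ∧ bq.2 ∈ X ∧ wlo ≤ bq.1 2 ∧ bq.1 2 ≤ whi)
    (hT₂pay : ∀ bq ∈ T₂, (X.filter fun q => dist bq.1 q = 1).card ≤ 11 ∨
      ∃ z₁ ∈ X, ∃ z₂ ∈ X, z₁ ≠ z₂ ∧ dist bq.1 z₁ = 1 ∧ dist bq.1 z₂ = 1 ∧
        (X.filter fun q => dist z₁ q = 1).card ≤ 11 ∧ (X.filter fun q => dist z₂ q = 1).card ≤ 11)
    (hT₂shape : ∀ bq ∈ T₂, ∃ r ∈ inPlaneRoots L 1, ∃ κ : List (EuclideanSpace ℝ (Fin 3)),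
        (∀ μ ∈ κ, ‖μ‖ = 1 ∧
          ∀ w ∈ fccSlots, ⟪w, μ⟫_ℝ = 0 ∨ ⟪w, μ⟫_ℝ = Real.sqrt (2 / 3) ∨ ⟪w, μ⟫_ℝ = -Real.sqrt (2 / 3)) ∧
        (∀ μ ∈ κ, ⟪r, μ⟫_ℝ = Real.sqrt (2 / 3) ∨ ⟪r, μ⟫_ℝ = -Real.sqrt (2 / 3)) ∧
        List.IsChain (fun μ μ' => ⟪μ, μ'⟫_ℝ = 1 / 3 ∨ ⟪μ, μ'⟫_ℝ = -1 / 3) (κ ++ [EuclideanSpace.single (2 : Fin 3) (1 : ℝ)]) ∧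
        (bq.1 = bq.2 + (⟨L, inPlaneRoots L 1⟩ : PlateSystem).Fw (κ ++ [EuclideanSpace.single (2 : Fin 3) (1 : ℝ)])
            (((-1 : ℝ) ^ (κ ++ [EuclideanSpace.single (2 : Fin 3) (1 : ℝ)]).length) • r) ∨
          ∃ m : EuclideanSpace ℝ (Fin 3), ‖m‖ = 1 ∧
            (∀ w ∈ fccSlots,
              ⟪(⟨L, inPlaneRoots L 1⟩ : PlateSystem).Fw (κ ++ [EuclideanSpace.single (2 : Fin 3) (1 : ℝ)]) w, m⟫_ℝ = 0 ∨
              ⟪(⟨L, inPlaneRoots L 1⟩ : PlateSystem).Fw (κ ++ [EuclideanSpace.single (2 : Fin 3) (1 : ℝ)]) w, m⟫_ℝ =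
                Real.sqrt (2 / 3) ∨
              ⟪(⟨L, inPlaneRoots L 1⟩ : PlateSystem).Fw (κ ++ [EuclideanSpace.single (2 : Fin 3) (1 : ℝ)]) w, m⟫_ℝ =
                -Real.sqrt (2 / 3)) ∧
            ⟪(⟨L, inPlaneRoots L 1⟩ : PlateSystem).Fw (κ ++ [EuclideanSpace.single (2 : Fin 3) (1 : ℝ)])
              (((-1 : ℝ) ^ (κ ++ [EuclideanSpace.single (2 : Fin 3) (1 : ℝ)]).length) • r), m⟫_ℝ = Real.sqrt (2 / 3) ∧
            bq.1 = bq.2 - ((⟨L, inPlaneRoots L 1⟩ : PlateSystem).Fw (κ ++ [EuclideanSpace.single (2 : Fin 3) (1 : ℝ)])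
              (((-1 : ℝ) ^ (κ ++ [EuclideanSpace.single (2 : Fin 3) (1 : ℝ)]).length) • r) -
              (2 * ⟪(⟨L, inPlaneRoots L 1⟩ : PlateSystem).Fw (κ ++ [EuclideanSpace.single (2 : Fin 3) (1 : ℝ)])
                (((-1 : ℝ) ^ (κ ++ [EuclideanSpace.single (2 : Fin 3) (1 : ℝ)]).length) • r), m⟫_ℝ) • m)))
    (hT₂adm : ∀ bq ∈ T₂, ∃ (G' : EuclideanSpace ℝ (Fin 3) ≃ₗᵢ[ℝ] EuclideanSpace ℝ (Fin 3)) (d' : EuclideanSpace ℝ (Fin 3)),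
        PlateSystem.Adm ⟨((ℝ ∙ EuclideanSpace.single (2 : Fin 3) (1 : ℝ)).reflection).trans L,
          inPlaneRoots (((ℝ ∙ EuclideanSpace.single (2 : Fin 3) (1 : ℝ)).reflection).trans L) (-1)⟩ G' d' ∧
        bq.2 - d' ∈ X ∧ IsEndMove X ver G' d' bq.2 bq.1) :
    (T₁.card : ℝ) + T₂.card ≤
      sF * ∑ z ∈ X.filter (fun z => (X.filter fun q => dist z q = 1).card ≤ 11 ∧
          wlo - 1 ≤ z 2 ∧ z 2 ≤ whi + 1), ((12 : ℝ) - ((X.filter fun q => dist z q = 1).card : ℝ)) := by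
  set e₃ : EuclideanSpace ℝ (Fin 3) := EuclideanSpace.single (2 : Fin 3) (1 : ℝ) with he₃
  have he₃1 : ‖e₃‖ = 1 := by rw [he₃, PiLp.norm_single, norm_one]
  have he₃menu : ∀ w ∈ fccSlots, ⟪w, e₃⟫_ℝ = 0 ∨ ⟪w, e₃⟫_ℝ = Real.sqrt (2 / 3) ∨ ⟪w, e₃⟫_ℝ = -Real.sqrt (2 / 3) :=
    fun w hw => by rw [← apply_two_eq_inner_e₃]; exact slot_apply_two_cases hw
  set S₁ : PlateSystem := ⟨L, inPlaneRoots L 1⟩ with hS₁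
  set S₂ : PlateSystem := ⟨((ℝ ∙ e₃).reflection).trans L, inPlaneRoots (((ℝ ∙ e₃).reflection).trans L) (-1)⟩ with hS₂
  have hFc : ∀ μ κ, S₁.Fw (μ :: κ) = ((ℝ ∙ μ)ᗮ.reflection).trans (S₁.Fw κ) := fun μ κ => PlateSystem.fw_cons S₁ μ κ
  -- (1) the two pair sets are disjoint (shape LEMMA X″)
  have hdisj : Disjoint T₁ T₂ := by
    rw [Finset.disjoint_left]
    intro bq h₁ h₂
    obtain ⟨r₁, hr₁, κ₁, hWF₁, -, hmove₁⟩ := hT₁wit bq h₁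
    obtain ⟨r₂, hr₂, κ₂, hlet₂, hob₂, hch₂, hpat₂⟩ := hT₂shape bq h₂
    obtain ⟨hr₁S, hr₁n, hr₁up⟩ := mem_filter.1 hr₁
    obtain ⟨hr₂S, hr₂n, hr₂up⟩ := mem_filter.1 hr₂
    obtain ⟨hlet₁, hch₁⟩ := wfChain_letters hWF₁
    have hob₁ := wfChain_oblique hWF₁
    have hne : r₁ ≠ -r₂ := by
      intro h'
      rw [h', map_neg, PiLp.neg_apply] at hr₁up
      linarith
    have hre₁ : ⟪r₁, e₃⟫_ℝ = 0 := by rw [← apply_two_eq_inner_e₃]; exact hr₁n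
    have hre₂ : ⟪r₂, e₃⟫_ℝ = 0 := by rw [← apply_two_eq_inner_e₃]; exact hr₂n
    exact word_target_ne_twoPlate_shape₂ hFc hr₁S hr₂S hne hlet₁ hch₁ hob₁ he₃1 he₃menu hre₁ hre₂ hlet₂ hch₂ hob₂
      rfl rfl (shape_of_isEndMove hmove₁) hpat₂ rfl
  -- (2) every pair of the union is an (A)-END PAIR of the two plate systems
  set T := T₁.disjUnion T₂ hdisj with hT
  have hEP : ∀ bq ∈ T, IsEndPairA X ver S₁ S₂ bq.1 bq.2 := by
    intro bq hbq
    rcases mem_disjUnion.1 hbq with h₁ | h₂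
    · obtain ⟨hb, hq, -, -⟩ := hT₁pair bq h₁
      obtain ⟨r, hr, κ, hWF, hpred, hmove⟩ := hT₁wit bq h₁
      exact ⟨hq, hb, hT₁pay bq h₁, S₁.Fw κ, S₁.Fw κ (((-1 : ℝ) ^ κ.length) • r), Or.inl ⟨r, hr, κ, hWF, rfl, rfl⟩, hpred, hmove⟩
    · obtain ⟨hb, hq, -, -⟩ := hT₂pair bq h₂
      obtain ⟨G, d, hadm, hpred, hem⟩ := hT₂adm bq h₂
      exact ⟨hq, hb, hT₂pay bq h₂, G, d, Or.inr hadm, hpred, hem⟩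
  -- (3) the discharge of the local row
  set PAYW := X.filter (fun z => (X.filter fun q => dist z q = 1).card ≤ 11 ∧
    wlo - 1 ≤ z 2 ∧ z 2 ≤ whi + 1) with hPAYW
  have hTX : ∀ bq ∈ T, bq.1 ∈ X := by
    intro bq hbq
    rcases mem_disjUnion.1 hbq with h' | h'
    · exact (hT₁pair bq h').1
    · exact (hT₂pair bq h').1
  have hwin : ∀ bq ∈ T, wlo ≤ bq.1 2 ∧ bq.1 2 ≤ whi := by
    intro bq hbq
    rcases mem_disjUnion.1 hbq with h' | h'
    · obtain ⟨-, -, h4, h5⟩ := hT₁pair bq h'; exact ⟨h4, h5⟩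
    · obtain ⟨-, -, h4, h5⟩ := hT₂pair bq h'; exact ⟨h4, h5⟩
  have hpayT : ∀ bq ∈ T, (X.filter fun q => dist bq.1 q = 1).card ≤ 11 ∨
      ∃ z₁ ∈ X, ∃ z₂ ∈ X, z₁ ≠ z₂ ∧ dist bq.1 z₁ = 1 ∧ dist bq.1 z₂ = 1 ∧
        (X.filter fun q => dist z₁ q = 1).card ≤ 11 ∧ (X.filter fun q => dist z₂ q = 1).card ≤ 11 := by
    intro bq hbq
    rcases mem_disjUnion.1 hbq with h' | h'
    · exact hT₁pay bq h'
    · exact hT₂pay bq h'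
  have hclosed : ∀ bq ∈ T, ∀ z ∈ X, dist bq.1 z ≤ 1 → (X.filter fun q => dist z q = 1).card ≤ 11 → z ∈ PAYW := by
    intro bq hbq z hzX hdz hz11
    obtain ⟨h4, h5⟩ := hwin bq hbq
    have h2 : (z 2 - bq.1 2) ^ 2 ≤ 1 := by
      have := sq_sub_apply_le_dist_sq z bq.1 2
      rw [dist_comm] at hdz; nlinarith [this, hdz, dist_nonneg (x := z) (y := bq.1)]
    have h2' : |z 2 - bq.1 2| ≤ 1 := by rw [← sq_le_one_iff_abs_le_one]; exact h2
    obtain ⟨ha, hb⟩ := abs_le.1 h2'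
    exact mem_filter.2 ⟨hzX, hz11, by linarith, by linarith⟩
  have hpay : ∀ bq ∈ T, ∃ z ∈ X, dist bq.1 z ≤ 1 ∧ (X.filter fun q => dist z q = 1).card ≤ 11 := by
    intro bq hbq
    rcases hpayT bq hbq with h11 | ⟨z₁, hz₁, -, -, -, hd₁, -, hc₁, -⟩
    · exact ⟨bq.1, hTX bq hbq, by rw [dist_self]; norm_num, h11⟩
    · exact ⟨z₁, hz₁, hd₁.le, hc₁⟩
  -- the row's multiplicities dominate the pair counts
  have hmult : ∀ b, ((T.filter fun bq => bq.1 = b).card : ℝ) ≤ (endMultA X ver S₁ S₂ b : ℝ) := by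
    intro b
    have : (T.filter fun bq => bq.1 = b).card ≤ (X.filter fun q => IsEndPairA X ver S₁ S₂ b q).card := by
      refine card_le_card_of_injOn (fun bq => bq.2) (fun bq hbq => ?_) ?_
      · obtain ⟨hbqT, hb1⟩ := mem_filter.1 hbq
        have hep := hEP bq hbqT
        rw [hb1] at hep
        exact mem_coe.2 (mem_filter.2 ⟨hep.1, hep⟩)
      · intro bq hbq bq' hbq' heq
        obtain ⟨-, hb⟩ := mem_filter.1 (mem_coe.1 hbq)
        obtain ⟨-, hb'⟩ := mem_filter.1 (mem_coe.1 hbq')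
        exact Prod.ext (hb.trans hb'.symm) heq
    exact_mod_cast this
  have hDnn : ∀ b, 0 ≤ pooledDef X b := by
    intro b
    refine sum_nonneg fun z hz => ?_
    have : ((X.filter fun q => dist z q = 1).card : ℝ) ≤ 11 := by exact_mod_cast (mem_filter.1 hz).2.2
    linarith
  have hrow' : ∀ z ∈ PAYW,
      ∑ b ∈ X.filter (fun b => dist z b ≤ 1 ∧ 0 < (T.filter fun bq => bq.1 = b).card),
        ((T.filter fun bq => bq.1 = b).card : ℝ) /
          (∑ z' ∈ X.filter (fun z' => dist b z' ≤ 1 ∧ (X.filter fun q => dist z' q = 1).card ≤ 11),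
            ((12 : ℝ) - ((X.filter fun q => dist z' q = 1).card : ℝ))) ≤ sF := by
    intro z hz
    obtain ⟨hzX, hz11, -, -⟩ := mem_filter.1 hz
    have key := hrow X hX z hzX hz11
    refine le_trans ?_ key
    calc ∑ b ∈ X.filter (fun b => dist z b ≤ 1 ∧ 0 < (T.filter fun bq => bq.1 = b).card),
          ((T.filter fun bq => bq.1 = b).card : ℝ) / pooledDef X b
        ≤ ∑ b ∈ X.filter (fun b => dist z b ≤ 1 ∧ 0 < (T.filter fun bq => bq.1 = b).card),
          (endMultA X ver S₁ S₂ b : ℝ) / pooledDef X b :=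
          sum_le_sum fun b _ => div_le_div_of_nonneg_right (hmult b) (hDnn b)
      _ ≤ ∑ b ∈ X.filter (fun b => dist z b ≤ 1 ∧ 0 < endMultA X ver S₁ S₂ b),
          (endMultA X ver S₁ S₂ b : ℝ) / pooledDef X b := by
          refine sum_le_sum_of_subset_of_nonneg (fun b hb => ?_) fun b _ _ =>
            div_nonneg (Nat.cast_nonneg _) (hDnn b)
          obtain ⟨hbX, hd, hpos⟩ := mem_filter.1 hb
          refine mem_filter.2 ⟨hbX, hd, ?_⟩
          have := hmult b
          have hpos' : (0 : ℝ) < (T.filter fun bq => bq.1 = b).card := by exact_mod_cast hpos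
          exact_mod_cast (show (0 : ℝ) < endMultA X ver S₁ S₂ b by linarith)
  have key := card_endPairs_le_of_localRow T PAYW hTX (fun z hz => ⟨(mem_filter.1 hz).1, (mem_filter.1 hz).2.1⟩)
    hclosed hpay hrow'
  rw [hT, card_disjUnion] at key
  have : (((T₁.card + T₂.card : ℕ) : ℝ)) = (T₁.card : ℝ) + (T₂.card : ℝ) := by push_cast; ring
  rw [← this]; exact key

end Summit.Ventures.Crystal3D.Theorems

end
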